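import Mathlib
import Literature.NumberTheory.LFunctions.Zhang2022.SkeletonPartThree
import Literature.NumberTheory.LFunctions.Zhang2022.SkeletonAssembly
import Literature.Analysis.Complex.ArgumentPrincipleRectangle
import HarnessLib

/-!
# Zhang (2022) §8, Lemma 8.1 and its proof (PDF pp. 42–44): the typed statements, slice `Section8a`

Topic `Literature/NumberTheory/LFunctions/Zhang2022` (Landau–Siegel audit tree; verdict-neutral).
Y. Zhang, *Discrete mean estimates and the Landau–Siegel zero*, arXiv:2211.02515v1 (2022)
[Zhang2022LandauSiegel] — **an unrefereed manuscript under adjudication. Every `def … : Prop` below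
is a CLAIM OF THE MANUSCRIPT, STATED NOT ASSERTED; statement-only; typed ≠ discharged.
WHAT THIS IS NOT: any claim about Theorems 1–2 of the manuscript or about Landau–Siegel zeros.**

Campaign slice L2 row 6 (`plan/L2/ASSIGNMENTS.md` v3.1): tex `L2185–L2263`, PDF pp. 42–44 — the
statement of Lemma 8.1 (BANKED as `Skeleton.Lemma81 c′`, cited, not restated) and every step of its
proof, one declaration per DAG node (`plan/DAG.tsv` ids, first token of each docstring):

| DAG node | tex | p. | declaration | status here |
|---|---|---|---|---|
| `Z22:Lem8.1`, `Z22:§8.u001` | L2187–2190 | 42 | `Step8u001` (`abbrev` of the banked `Skeleton.Lemma81 c′`) | banked p403323 |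
| `Z22:§8.u002` | L2194 | 42 | `calCt` (`𝒞̃(s,ψ)`); bridge `calCt_eq_calCtilde` to `Lemma81.calCtilde` | object; bridge PROVED |
| `Z22:§8.u003` | L2197–2201 | 42 | `rectR`, `onBoundaryR` (objects), `Step8u003 c′` (the rectangle `ℜ` exists) | CLAIM |
| `Z22:(8.1)` | L2202–2206 | 42 | `sumZeros`, `rectIntegral` (objects), `Eq81a c′` (residue identity), `Eq81b c′` (`= Ĩ₁⁺ − Ĩ₁⁻ + O(ε)`), `Eq81 c′` (as printed) | CLAIMS |
| `Z22:§8.u004` | L2208–2210 | 42 | `Itil` (`Ĩ₁^{±}(𝐚₁,𝐚₂;ψ)`); bridge `Itil_eq_Itilde` to `Lemma81.Itilde` | object; bridge PROVED |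
| `Z22:§8.u005` | L2211–2214 | 43 | `sPrime` (`s′ = 1 − s̄`), `onJ` (`s ∈ 𝔍(z)`) | objects |
| `Z22:§8.u006` | L2215–2218 | 43 | `Step8u006` + `step8u006_holds` (tree `Lemma81.one_sub_conj_eq`) | PROVED |
| `Z22:§8.u007` | L2219–2222 | 43 | `Step8u007 c′` (`conj 𝒞̃(s,ψ) = −𝒞̃(s′,ψ)` on `𝔍(α)`) + `step8u007_holds` (tree `Lemma81.conj_calCtilde_eq`) | PROVED |
| `Z22:§8.u008` | L2223–2226 | 43 | `Step8u008` + `step8u008_holds` (tree `Lemma81.conj_dirPoly_mul_omega`) | PROVED |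
| `Z22:§8.u009` | L2227–2230 | 43 | `Step8u009 c′` (`−Ĩ₁⁻ = conj Ĩ₁⁺(ā₂,ā₁)`) + `step8u009_holds` (tree `Lemma81.neg_Itilde_neg_eq_conj`) | PROVED |
| `Z22:§8.u010` | L2231–2235 | 43 | `Step8u010 c′` ("Hence, by (8.6) [sc. (8.1)]") + edge `step8u010_of : Eq81 → Step8u009 → Step8u010` | CLAIM; edge PROVED |
| `Z22:§8.u011` | L2236–2239 | 43 | `IonePlus` (`I₁⁺(𝐚₁,𝐚₂;ψ)`, with `𝒞` not `𝒞̃`) | object |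
| `Z22:§8.u012` | L2240–2243 | 43 | `Step8u012 c′` (`Ĩ₁⁺ − I₁⁺ ≪ 𝓛⁻¹¹⁴∫_{𝔍(α)}\|LLAAω ds\|`, "By Lemma 5.2 and 5.9") | CLAIM |
| `Z22:§8.u013` | L2244–2247 | 43 | `Step8u013 c′` (`Σ_{Ψ₁}\|L(s+β₂,ψ)L(s+β₃,ψ)\|² ≪ P²𝓛³⁶`) | CLAIM |
| `Z22:§8.u014` | L2248–2250 | 43 | `Step8u014` (`Σ_{Ψ₁}\|A(𝐚₁;s,ψ)A(𝐚₂;1−s,ψ̄)\|² ≪ P²𝓛³⁶`) | CLAIM |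
| `Z22:§8.u015` | L2251–2254 | 43 | `Step8u015 c′` (`Σ_{Ψ₁}(Ĩ₁⁺ − I₁⁺) = o(𝔓)`, "with (7.4) and (2.9)") | CLAIM |
| `Z22:§8.u016` | L2255–2258 | 43 | `Step8u016 c′` ("moving `𝔍(α)` to `𝔍(1)`": `Σ_{Ψ₁}I₁⁺ = Θ₁ + O(ε)`) | CLAIM |
| `Z22:§8.u017` | L2259–2263 | 44 | `Step8u017 c′` (`Σ_{Ψ₁}Ĩ₁⁺ = Θ₁ + o(𝔓)`; by symmetry also for `(ā₂,ā₁)`) + edge `step8u017_of` | CLAIM; edge PROVED |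
| `Z22:Lem8.1.pf` | L2193–2263 | 42–44 | `CardPsiOneLe` (implicit input `#Ψ₁ ≤ 𝔓`), `DedLem81 c′ : Step8u010 → Step8u017 → CardPsiOneLe → Skeleton.Lemma81` (refines `Skeleton.Ded81 c′`) + `dedLem81_holds` | edge PROVED |

Conventions (skel/INTERFACE.md §3, `SkeletonPropositions`): `ForAllLarge`; "`+O(ε)`" with Zhang's
negligible `ε = exp{−c𝓛¹⁰}` (§4, tex L1062) is `∃ c > 0, ∃ C, … ≤ C·exp(−c𝓛¹⁰)` (as in
`Skeleton.Lemma61`); "`≪ X`" is `∃ C, … ≤ C·X`; "`o(𝔓)`" is `∀ ε > 0, … ≤ ε𝔓`; claims of §8 carry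
`Skeleton.AssumptionA D χ →` (the manuscript's blanket assumption from §5 on, tex L1560); the sequences
`𝐚₁, 𝐚₂` range over `Skeleton.Adm72 D B` ((7.2), "`a(n) ≪ 1`" with an explicit bound `B`, on which the
implied constants may depend — hence `∀ B` outermost); the constant `c′` of (2.13) is explicit.
`𝔍(z)` is the segment `[s₀ + z − i𝓛₁, s₀ + z + i𝓛₁]` (§7 p.33, tex L1824), integrals over it are the
tree's `Lemma81.segInt (t0 D) (ell1 D) z` (parametrisation `s = z + s₀ + iv`, `ds = i dv`, prefactor
`1/2πi`), exactly as in the banked `Skeleton.Theta1`.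

Editorial notes (recorded, not repaired): the statement and proof print the zero set as `Z̃(ψ)`
(TeX macro `\tz`, elsewhere the FUNCTION `Z̃(s,ψ)` of (4.4)); it is read, as in the banked
`Skeleton.Lemma81`/`Skeleton.idx`, as the zero set `𝒵(ψ)` of (2.14) (`Skeleton.zeroSet`), the only
reading under which the sentence parses (AMBIGUITY flagged). "Hence, by (8.6)" (tex L2231) cites a
LATER display; (8.1) is meant. "`∫_{𝔍(α)}|… ds|`" (tex L2242) is read as `∫|…||ds|`.

What is PROVED here (from tree theorems only; no new facts): the bridges `beta_eq_b_mul_I`,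
`calCt_eq_calCtilde`, `Itil_eq_Itilde` (our `𝒞̃`, `Ĩ₁^{±}` over the skeleton's objects ARE the
`Section8Reflection` ones), `step8u006_holds`, `step8u007_holds`, `step8u008_holds`, `step8u009_holds`
(the four reflection steps, from `Section8Reflection`), and the bookkeeping edges `step8u010_of`,
`step8u017_of`, `dedLem81_holds` (the proof's own "These together imply" / "Hence" / "This completes
the proof" steps). NOT proved: `Step8u003` (Prop. 2.2 ⇒ the rectangle), `Eq81a/b` (Lemma 5.9 +
residue theorem + "a simple bound for `ω`"), `Step8u012`–`Step8u016` (Lemmas 5.2, 5.9, 6.1, 3.3,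
(7.4), (2.9), the contour shift to `𝔍(1)`).

## References

* Y. Zhang, arXiv:2211.02515v1 (2022), §8 Lemma 8.1 and its proof, PDF pp. 42–44, tex L2185–2263;
  §7 p.33 (tex L1824) for `𝔍(z)`; §4 (tex L1062) for `ε`. [cite: Zhang2022LandauSiegel, §8 Lemma 8.1 pp.42–44]
-/

noncomputable section

open Complex Real ComplexConjugate

namespace Literature.NumberTheory.LFunctions.Zhang2022.Section8aStatements

open Skeleton

/-! ## Lemma 8.1 (banked) -/

/-- `Z22:Lem8.1` `Z22:§8.u001` (p.42, tex L2187–2190): **Lemma 8.1** "For any `𝐚₁` and `𝐚₂`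
satisfying (7.2), `Σ_{ψ∈Ψ₁}Σ_{ρ∈Z̃(ψ)} 𝒞*(ρ,ψ)A(𝐚₁;ρ,ψ)A(𝐚₂,1−ρ,ψ̄)ω(ρ) = Θ₁(𝐚₁,𝐚₂) + conj Θ₁(ā₂,ā₁)
+ o(𝔓)`" — BANKED as `Skeleton.Lemma81 c′` (p403323); this is a reference, not a restatement
(`Z̃(ψ)` = the zero set `𝒵(ψ)` of (2.14), see the module docstring).
[cite: Zhang2022LandauSiegel, §8 Lemma 8.1 p.42, tex L2187] -/
abbrev Step8u001 (c' : ℝ) : Prop := Skeleton.Lemma81 c'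

/-! ## The objects of the proof: `𝒞̃`, the rectangle `ℜ`, `Ĩ₁^{±}`, `s′`, `𝔍(z)`, `I₁⁺` -/

section Objects

variable (c' : ℝ) {D : ℕ}

omit c' in
/-- The shifts `β_j = ib_j` of (2.13): the skeleton's complex `beta_j` is `i` times its real `b_j`.
[cite: Zhang2022LandauSiegel, §2 (2.13) p.5] -/
theorem beta_eq_b_mul_I (c' : ℝ) (D : ℕ) :
    beta1 c' D = (b1 c' D : ℂ) * I ∧ beta2 c' D = (b2 c' D : ℂ) * I ∧ beta3 c' D = (b3 c' D : ℂ) * I := by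
  refine ⟨?_, ?_, ?_⟩
  · simp only [beta1, b1]; push_cast; ring
  · simp only [beta2, b2]; push_cast; ring
  · simp only [beta3, b3]; push_cast; ring

variable (x : Chr D)

/-- `Z22:§8.u002` OBJECT (p.42, tex L2194): "Write
`𝒞̃(s,ψ) = −i M(s+β₁,ψ)M(s+β₂,ψ)M(s+β₃,ψ)/M(s,ψ)`" (`M = Skeleton.Mfun`, `β_j = Skeleton.beta_j c′`).
[cite: Zhang2022LandauSiegel, §8 p.42, tex L2194] -/
def calCt (s : ℂ) : ℂ :=
  -I * (Mfun x.ψ (s + beta1 c' D) * Mfun x.ψ (s + beta2 c' D) * Mfun x.ψ (s + beta3 c' D)) /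
    Mfun x.ψ s

/-- Bridge: our `𝒞̃(s,ψ)` IS the tree's `Lemma81.calCtilde ψ Y b₁ b₂ b₃ s` (`Section8Reflection`) with
`Y = Skeleton.Yroot ψ` and the real shift sizes `b_j`. [cite: Zhang2022LandauSiegel, §8 p.42, tex L2194] -/
theorem calCt_eq_calCtilde (s : ℂ) :
    calCt c' x s = Lemma81.calCtilde x.ψ (Yroot x.ψ) (b1 c' D) (b2 c' D) (b3 c' D) s := by
  obtain ⟨h1, h2, h3⟩ := beta_eq_b_mul_I c' D
  simp only [calCt, Lemma81.calCtilde, Mfun, h1, h2, h3]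

omit x in
/-- `Z22:§8.u003` OBJECT (p.42, tex L2197–2200): the open rectangle `ℜ` "with vertices at
`s₀ ± α + i𝓛₁^{±}`", i.e. `1/2 − α < σ < 1/2 + α`, `2πt₀ + 𝓛₁⁻ < t < 2πt₀ + 𝓛₁⁺` (`s₀ = ½ + 2πit₀`).
[cite: Zhang2022LandauSiegel, §8 p.42, tex L2197–2200] -/
def rectR (D : ℕ) (Lm Lp : ℝ) : Set ℂ :=
  {s | |s.re - 1 / 2| < alpha D ∧ 2 * π * t0 D + Lm < s.im ∧ s.im < 2 * π * t0 D + Lp}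

omit x in
/-- `Z22:§8.u003` OBJECT: the boundary `∂ℜ` of the rectangle (the contour of (8.1)): the closed
rectangle minus the open one. [cite: Zhang2022LandauSiegel, §8 p.42, tex L2197–2201] -/
def onBoundaryR (D : ℕ) (Lm Lp : ℝ) : Set ℂ :=
  {s | |s.re - 1 / 2| ≤ alpha D ∧ 2 * π * t0 D + Lm ≤ s.im ∧ s.im ≤ 2 * π * t0 D + Lp} \ rectR D Lm Lp

omit x in
/-- `Z22:§8.u003` OBJECT: admissibility of a pair of heights `(𝓛₁⁻, 𝓛₁⁺)` for `ψ`, as the text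
requires — "`𝓛₁^{±} = ±𝓛₁ + O(α)`" (constant `C`), "the set of zeros of `L(s,ψ)` inside `ℜ` is exactly
`Z̃(ψ)` [= `𝒵(ψ)`]", and "without loss of generality … `|s − ρ| ≫ α` if `s ∈ ℜ` [on the contour] and
`ρ` is a zero of `L(s,ψ)`" (constant `c₀`). [cite: Zhang2022LandauSiegel, §8 p.42, tex L2197–2201] -/
def AdmRect (D : ℕ) (x : Chr D) (C c₀ Lm Lp : ℝ) : Prop :=
  |Lp - ell1 D| ≤ C * alpha D ∧ |Lm + ell1 D| ≤ C * alpha D ∧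
    {ρ | x.ψ.LFunction ρ = 0 ∧ ρ ∈ rectR D Lm Lp} = zeroSet D x ∧
    ∀ s ∈ onBoundaryR D Lm Lp, ∀ ρ : ℂ, x.ψ.LFunction ρ = 0 → c₀ * alpha D ≤ ‖s - ρ‖

omit x in
/-- `Z22:(8.1)` OBJECT: the contour integral `(1/2πi)∫_ℜ F(s) ds` over `∂ℜ`, counter-clockwise — the
tree's four-term `Literature.Analysis.Complex.rectBoundaryIntegral` on
`[½ − α, ½ + α] × [2πt₀ + 𝓛₁⁻, 2πt₀ + 𝓛₁⁺]`, divided by `2πi`. [cite: Zhang2022LandauSiegel, §8 (8.1) p.42, tex L2203] -/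
def rectIntegral (D : ℕ) (Lm Lp : ℝ) (F : ℂ → ℂ) : ℂ :=
  (1 / (2 * π * I)) *
    Literature.Analysis.Complex.rectBoundaryIntegral F (1 / 2 - alpha D) (1 / 2 + alpha D)
      (2 * π * t0 D + Lm) (2 * π * t0 D + Lp)

/-- `Z22:(8.1)` OBJECT: the left side `Σ_{ρ∈𝒵(ψ)} 𝒞*(ρ,ψ)A(𝐚₁;ρ,ψ)A(𝐚₂,1−ρ,ψ̄)ω(ρ)` for ONE `ψ`
(the inner sum of `Skeleton.lhs81`; `lhs81_eq_sum_sumZeros`). [cite: Zhang2022LandauSiegel, §8 (8.1) p.42, tex L2203] -/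
def sumZeros (a₁ a₂ : ℕ → ℂ) : ℂ :=
  ∑ ρ ∈ finsetOf (zeroSet D x),
    cstar c' D x ρ * Apoly x a₁ ρ * ApolyBar x a₂ (1 - ρ) * omegaW D ρ

/-- The integrand `𝒞̃(s,ψ)A(𝐚₁;s,ψ)A(𝐚₂,1−s,ψ̄)ω(s)` of (8.1) and of `Ĩ₁^{±}`.
[cite: Zhang2022LandauSiegel, §8 (8.1) p.42, tex L2203–2210] -/
def integrandTilde (a₁ a₂ : ℕ → ℂ) (s : ℂ) : ℂ :=
  calCt c' x s * Apoly x a₁ s * ApolyBar x a₂ (1 - s) * omegaW D s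

/-- `Z22:§8.u004` OBJECT (p.42, tex L2208–2210): "`Ĩ₁^{±}(𝐚₁,𝐚₂;ψ) = (1/2πi)∫_{𝔍(±α)} 𝒞̃(s,ψ)
A(𝐚₁;s,ψ)A(𝐚₂,1−s,ψ̄)ω(s) ds`", here at a general abscissa `z` (`z = ±α`: `Itil c′ x (alpha D)`,
`Itil c′ x (−alpha D)`), via the tree's `Lemma81.segInt` as in `Skeleton.Theta1`.
[cite: Zhang2022LandauSiegel, §8 p.42, tex L2208–2210] -/
def Itil (z : ℝ) (a₁ a₂ : ℕ → ℂ) : ℂ :=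
  Lemma81.segInt (t0 D) (ell1 D) (z : ℂ) (integrandTilde c' x a₁ a₂)

/-- Bridge: our `Ĩ₁^{±}` IS the tree's `Lemma81.Itilde` (`Section8Reflection`) at the skeleton's data
(`Y = Yroot ψ`, `v_j = b_j`, `N = ⌈PT⁻²⌉`, `𝓛₂`, `t₀`, `𝓛₁`). [cite: Zhang2022LandauSiegel, §8 p.42, tex L2208–2210] -/
theorem Itil_eq_Itilde (z : ℝ) (a₁ a₂ : ℕ → ℂ) :
    Itil c' x z a₁ a₂ = Lemma81.Itilde x.ψ (Yroot x.ψ) (b1 c' D) (b2 c' D) (b3 c' D) (Nsupp D)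
      (ell2 D) (t0 D) (ell1 D) (z : ℂ) a₁ a₂ := by
  rw [Itil, Lemma81.Itilde_def]
  congr 1
  funext s
  rw [integrandTilde, calCt_eq_calCtilde, Apoly, ApolyBar, omegaW]
  ring

omit c' x in
/-- `Z22:§8.u005` OBJECT (p.43, tex L2211): "Write `s′ = 1 − s̄`." [cite: Zhang2022LandauSiegel, §8 p.43, tex L2211] -/
def sPrime (s : ℂ) : ℂ := 1 - conj s

omit c' x in
/-- `Z22:§8.u005` OBJECT (p.43, tex L2212–2214; §7 p.33, tex L1824): membership of the segment
`𝔍(z) = [s₀ + z − i𝓛₁, s₀ + z + i𝓛₁]`: "`s = z + s₀ + iv`" with `|v| ≤ 𝓛₁`.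
[cite: Zhang2022LandauSiegel, §8 p.43, tex L2212–2214] -/
def onJ (D : ℕ) (z : ℝ) (s : ℂ) : Prop :=
  ∃ v : ℝ, |v| ≤ ell1 D ∧ s = (z : ℂ) + s0 D + v * I

/-- The integrand `𝒞(s,ψ)A(𝐚₁;s,ψ)A(𝐚₂,1−s,ψ̄)ω(s)` of `I₁⁺` and of `Θ₁` (`𝒞 = Skeleton.frakcW`, (7.1)).
[cite: Zhang2022LandauSiegel, §8 p.43, tex L2238] -/
def integrandC (a₁ a₂ : ℕ → ℂ) (s : ℂ) : ℂ :=
  frakcW c' x s * Apoly x a₁ s * ApolyBar x a₂ (1 - s) * omegaW D s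

/-- `Z22:§8.u011` OBJECT (p.43, tex L2236–2239): "Write `I₁⁺(𝐚₁,𝐚₂;ψ) = (1/2πi)∫_{𝔍(α)} 𝒞(s,ψ)
A(𝐚₁;s,ψ)A(𝐚₂,1−s,ψ̄)ω(s) ds`" (with `𝒞` of (7.1), not `𝒞̃`).
[cite: Zhang2022LandauSiegel, §8 p.43, tex L2236–2239] -/
def IonePlus (a₁ a₂ : ℕ → ℂ) : ℂ :=
  Lemma81.segInt (t0 D) (ell1 D) (alpha D : ℂ) (integrandC c' x a₁ a₂)

omit x in
/-- `Skeleton.Theta1 c′ χ 𝐚₁ 𝐚₂ = Σ_{ψ∈Ψ₁} (1/2πi)∫_{𝔍(1)} integrandC` (the banked definition, restated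
with our integrand name for the contour shift `𝔍(α) → 𝔍(1)` of §8.u016). [cite: Zhang2022LandauSiegel, §7 Prop. 7.1 p.33] -/
theorem Theta1_eq_sum_segInt [NeZero D] (χ : DirichletCharacter ℂ D) (a₁ a₂ : ℕ → ℂ) :
    Theta1 c' χ a₁ a₂ =
      ∑ x ∈ finsetOf (PsiOne χ), Lemma81.segInt (t0 D) (ell1 D) 1 (integrandC c' x a₁ a₂) := rfl

omit x in
/-- `Skeleton.lhs81 c′ χ 𝐚₁ 𝐚₂ = Σ_{ψ∈Ψ₁} sumZeros` (the banked left side of Lemma 8.1 is the sum over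
`Ψ₁` of the one-`ψ` sums of (8.1)). [cite: Zhang2022LandauSiegel, §8 Lemma 8.1 p.42] -/
theorem lhs81_eq_sum_sumZeros [NeZero D] (χ : DirichletCharacter ℂ D) (a₁ a₂ : ℕ → ℂ) :
    lhs81 c' χ a₁ a₂ = ∑ x ∈ finsetOf (PsiOne χ), sumZeros c' x a₁ a₂ := by
  rw [lhs81, idx, Finset.sum_sigma]
  rfl

end Objects

/-! ## The steps of the proof, as claims -/

section Claims

variable (c' : ℝ)

/-- `Z22:§8.u003` CLAIM (p.42, tex L2197–2201): "Assume `ψ ∈ Ψ₁`. By Proposition 2.2, we can choose a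
rectangle `ℜ` with vertices at `s₀ ± α + i𝓛₁^{±}` such that `𝓛₁^{±} = ±𝓛₁ + O(α)` and such that the set
of zeros of `L(s,ψ)` inside `ℜ` is exactly `Z̃(ψ)` [= `𝒵(ψ)`]. Further, without loss of generality, we
can assume that `|s − ρ| ≫ α` if `s ∈ ℜ` and `ρ` is a zero of `L(s,ψ)`" — typed: with absolute
constants `C, c₀ > 0`, for all large `D`, every `ψ ∈ Ψ₁` admits such heights (`AdmRect`). Input:
`Skeleton.Prop22 c′`. [cite: Zhang2022LandauSiegel, §8 p.42, tex L2197–2201] -/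
def Step8u003 : Prop :=
  ∃ C : ℝ, ∃ c₀ : ℝ, 0 < c₀ ∧ ForAllLarge fun D _ χ => AssumptionA D χ →
    ∀ x ∈ PsiOne χ, ∃ Lm Lp : ℝ, AdmRect D x C c₀ Lm Lp

/-- `Z22:(8.1)` CLAIM, first equality (p.42, tex L2202–2203): "By Lemma 5.9 [and] the residue theorem …
`Σ_{ρ∈Z̃(ψ)} 𝒞*(ρ,ψ)A(𝐚₁;ρ,ψ)A(𝐚₂,1−ρ,ψ̄)ω(ρ) = (1/2πi)∫_ℜ 𝒞̃(s,ψ)A(𝐚₁;s,ψ)A(𝐚₂,1−s,ψ̄)ω(s) ds`"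
— for every admissible rectangle with clearance constant `c₀ > 0` (no zero on `∂ℜ`; the residue of
`𝒞̃AAω` at a simple zero `ρ` of `M(·,ψ)` is `𝒞*(ρ,ψ)A(𝐚₁;ρ)A(𝐚₂;1−ρ)ω(ρ)`). Inputs: `Skeleton.Prop22 c′`
(critical line, simple zeros), `Skeleton.Lemma59 c′`.
[cite: Zhang2022LandauSiegel, §8 (8.1) p.42, tex L2202–2203] -/
def Eq81a : Prop :=
  ∀ B C c₀ : ℝ, 0 < c₀ → ForAllLarge fun D _ χ => AssumptionA D χ →
    ∀ a₁ a₂ : ℕ → ℂ, Adm72 D B a₁ → Adm72 D B a₂ → ∀ x ∈ PsiOne χ, ∀ Lm Lp : ℝ,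
      AdmRect D x C c₀ Lm Lp →
        sumZeros c' x a₁ a₂ = rectIntegral D Lm Lp (integrandTilde c' x a₁ a₂)

/-- `Z22:(8.1)` CLAIM, second equality (p.42, tex L2203–2205): "… and a simple bound for `ω(s)`,
`(1/2πi)∫_ℜ 𝒞̃AAω ds = Ĩ₁⁺(𝐚₁,𝐚₂;ψ) − Ĩ₁⁻(𝐚₁,𝐚₂;ψ) + O(ε)`" (`ε = exp{−c𝓛¹⁰}`; the horizontal edges
and the `O(α)`-ends of the vertical edges are negligible because `ω` is, there).
[cite: Zhang2022LandauSiegel, §8 (8.1) p.42, tex L2203–2205] -/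
def Eq81b : Prop :=
  ∀ B C c₀ : ℝ, 0 < c₀ → ∃ c : ℝ, 0 < c ∧ ∃ C' : ℝ, ForAllLarge fun D _ χ => AssumptionA D χ →
    ∀ a₁ a₂ : ℕ → ℂ, Adm72 D B a₁ → Adm72 D B a₂ → ∀ x ∈ PsiOne χ, ∀ Lm Lp : ℝ,
      AdmRect D x C c₀ Lm Lp →
        ‖rectIntegral D Lm Lp (integrandTilde c' x a₁ a₂) -
            (Itil c' x (alpha D) a₁ a₂ - Itil c' x (-alpha D) a₁ a₂)‖ ≤
          C' * Real.exp (-c * ell D ^ 10)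

/-- `Z22:(8.1)` CLAIM as printed, end to end (p.42, tex L2202–2206): for `ψ ∈ Ψ₁` and `𝐚₁, 𝐚₂`
satisfying (7.2), "`Σ_{ρ∈Z̃(ψ)} 𝒞*(ρ,ψ)A(𝐚₁;ρ,ψ)A(𝐚₂,1−ρ,ψ̄)ω(ρ) = Ĩ₁⁺(𝐚₁,𝐚₂;ψ) − Ĩ₁⁻(𝐚₁,𝐚₂;ψ) + O(ε)`"
(uniformly in `ψ ∈ Ψ₁`; `ε = exp{−c𝓛¹⁰}`). [cite: Zhang2022LandauSiegel, §8 (8.1) p.42, tex L2202–2206] -/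
def Eq81 : Prop :=
  ∀ B : ℝ, ∃ c : ℝ, 0 < c ∧ ∃ C : ℝ, ForAllLarge fun D _ χ => AssumptionA D χ →
    ∀ a₁ a₂ : ℕ → ℂ, Adm72 D B a₁ → Adm72 D B a₂ → ∀ x ∈ PsiOne χ,
      ‖sumZeros c' x a₁ a₂ - (Itil c' x (alpha D) a₁ a₂ - Itil c' x (-alpha D) a₁ a₂)‖ ≤
        C * Real.exp (-c * ell D ^ 10)

/-- `Z22:§8.u006` CLAIM (p.43, tex L2215–2218): "If `s = α + s₀ + iv ∈ 𝔍(α)` then `s′ = −α + s₀ + iv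
∈ 𝔍(−α)`" (`s′ = 1 − s̄`, `s₀ = ½ + 2πit₀`), for every real `a` in place of `α`. PROVED:
`step8u006_holds`. [cite: Zhang2022LandauSiegel, §8 p.43, tex L2215–2218] -/
def Step8u006 : Prop :=
  ∀ (D : ℕ) (a v : ℝ), sPrime ((a : ℂ) + s0 D + v * I) = ((-a : ℝ) : ℂ) + s0 D + v * I

omit c' in
/-- `Z22:§8.u006` holds (the tree's `Lemma81.one_sub_conj_eq`, `Section8Reflection`).
[cite: Zhang2022LandauSiegel, §8 p.43, tex L2215–2218] -/
theorem step8u006_holds : Step8u006 := fun D a v => Lemma81.one_sub_conj_eq (t0 D) a v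

/-- `Z22:§8.u007` CLAIM (p.43, tex L2219–2222): "By (2.11) and analytic continuation, for `s ∈ 𝔍(α)`
we have `conj 𝒞̃(s,ψ) = −𝒞̃(s′,ψ)`" (for all large `D`, every `ψ ∈ Ψ`). PROVED: `step8u007_holds`.
[cite: Zhang2022LandauSiegel, §8 p.43, tex L2219–2222] -/
def Step8u007 : Prop :=
  ForAllLarge fun D _ _ => ∀ x : Chr D, ∀ s : ℂ, onJ D (alpha D) s →
    conj (calCt c' x s) = -calCt c' x (sPrime s)

/-- `Z22:§8.u008` CLAIM (p.43, tex L2223–2226): "`conj(A(𝐚₁;s,ψ)A(𝐚₂,1−s,ψ̄)ω(s))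
= A(ā₂;s′,ψ)A(ā₁,1−s′,ψ̄)ω(s′)`" (`ā(n) = conj a(n)`; at every `s`). PROVED: `step8u008_holds`.
[cite: Zhang2022LandauSiegel, §8 p.43, tex L2223–2226] -/
def Step8u008 : Prop :=
  ∀ (D : ℕ) (x : Chr D) (a₁ a₂ : ℕ → ℂ) (s : ℂ),
    conj (Apoly x a₁ s * ApolyBar x a₂ (1 - s) * omegaW D s) =
      Apoly x (fun n => conj (a₂ n)) (sPrime s) * ApolyBar x (fun n => conj (a₁ n)) (1 - sPrime s) *
        omegaW D (sPrime s)

omit c' in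
/-- `Z22:§8.u008` holds (the tree's `Lemma81.conj_dirPoly_mul_omega`).
[cite: Zhang2022LandauSiegel, §8 p.43, tex L2223–2226] -/
theorem step8u008_holds : Step8u008 := fun D x a₁ a₂ s =>
  Lemma81.conj_dirPoly_mul_omega (Nsupp D) a₁ a₂ x.ψ (ell2 D) (t0 D) s

/-- `Z22:§8.u009` CLAIM (p.43, tex L2227–2230): "These together imply that
`−Ĩ₁⁻(𝐚₁,𝐚₂;ψ) = conj Ĩ₁⁺(ā₂,ā₁;ψ)`" (for all large `D`, every `ψ ∈ Ψ`, all `𝐚₁, 𝐚₂`). PROVED: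
`step8u009_holds`. [cite: Zhang2022LandauSiegel, §8 p.43, tex L2227–2230] -/
def Step8u009 : Prop :=
  ForAllLarge fun D _ _ => ∀ x : Chr D, ∀ a₁ a₂ : ℕ → ℂ,
    -Itil c' x (-alpha D) a₁ a₂ =
      conj (Itil c' x (alpha D) (fun n => conj (a₂ n)) (fun n => conj (a₁ n)))

/-- `Z22:§8.u010` CLAIM (p.43, tex L2231–2235): "Hence, by (8.6) [sc. (8.1)],
`Σ_{ρ∈Z̃(ψ)} 𝒞*(ρ,ψ)A(𝐚₁;ρ,ψ)A(𝐚₂,1−ρ,ψ̄)ω(ρ) = Ĩ₁⁺(𝐚₁,𝐚₂;ψ) + conj Ĩ₁⁺(ā₂,ā₁;ψ) + O(ε)`".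
Edge: `step8u010_of`. [cite: Zhang2022LandauSiegel, §8 p.43, tex L2231–2235] -/
def Step8u010 : Prop :=
  ∀ B : ℝ, ∃ c : ℝ, 0 < c ∧ ∃ C : ℝ, ForAllLarge fun D _ χ => AssumptionA D χ →
    ∀ a₁ a₂ : ℕ → ℂ, Adm72 D B a₁ → Adm72 D B a₂ → ∀ x ∈ PsiOne χ,
      ‖sumZeros c' x a₁ a₂ - (Itil c' x (alpha D) a₁ a₂ +
          conj (Itil c' x (alpha D) (fun n => conj (a₂ n)) (fun n => conj (a₁ n))))‖ ≤
        C * Real.exp (-c * ell D ^ 10)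

/-- `Z22:§8.u012` CLAIM (p.43, tex L2240–2243): "By Lemma 5.2 and 5.9,
`Ĩ₁⁺(𝐚₁,𝐚₂;ψ) − I₁⁺(𝐚₁,𝐚₂;ψ) ≪ 𝓛⁻¹¹⁴ ∫_{𝔍(α)} |L(s+β₂,ψ)L(s+β₃,ψ)A(𝐚₁;s,ψ)A(𝐚₂,1−s,ψ̄)ω(s) ds|`"
(for `ψ ∈ Ψ₁`; the integral read as `∫|…||ds|` in the parametrisation `s = α + s₀ + iv`).
Inputs: `Skeleton.Lemma52 c′`, `Skeleton.Lemma59 c′`. [cite: Zhang2022LandauSiegel, §8 p.43, tex L2240–2243] -/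
def Step8u012 : Prop :=
  ∀ B : ℝ, ∃ C : ℝ, ForAllLarge fun D _ χ => AssumptionA D χ →
    ∀ a₁ a₂ : ℕ → ℂ, Adm72 D B a₁ → Adm72 D B a₂ → ∀ x ∈ PsiOne χ,
      ‖Itil c' x (alpha D) a₁ a₂ - IonePlus c' x a₁ a₂‖ ≤
        C * (ell D ^ 114)⁻¹ * ∫ v in (-ell1 D)..ell1 D,
          ‖x.ψ.LFunction ((alpha D : ℂ) + s0 D + v * I + beta2 c' D) *
              x.ψ.LFunction ((alpha D : ℂ) + s0 D + v * I + beta3 c' D) *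
            Apoly x a₁ ((alpha D : ℂ) + s0 D + v * I) *
              ApolyBar x a₂ (1 - ((alpha D : ℂ) + s0 D + v * I)) *
            omegaW D ((alpha D : ℂ) + s0 D + v * I)‖

/-- `Z22:§8.u013` CLAIM (p.43, tex L2244–2247): "By Cauchy's inequality, Lemma 6.1, and the second
assertion of Lemma 3.3, for `s ∈ 𝔍(α)`, `Σ_{ψ∈Ψ₁} |L(s+β₂,ψ)L(s+β₃,ψ)|² ≪ P²𝓛³⁶`". Inputs:
`Skeleton.Lemma61`, `Skeleton.Lemma33b`. [cite: Zhang2022LandauSiegel, §8 p.43, tex L2244–2247] -/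
def Step8u013 : Prop :=
  ∃ C : ℝ, ForAllLarge fun D _ χ => AssumptionA D χ → ∀ s : ℂ, onJ D (alpha D) s →
    ∑ x ∈ finsetOf (PsiOne χ),
        ‖x.ψ.LFunction (s + beta2 c' D) * x.ψ.LFunction (s + beta3 c' D)‖ ^ 2 ≤
      C * bigP D ^ 2 * ell D ^ 36

/-- `Z22:§8.u014` CLAIM (p.43, tex L2248–2250): (same lead-in) "for `s ∈ 𝔍(α)`,
`Σ_{ψ∈Ψ₁} |A(𝐚₁;s,ψ)A(𝐚₂,1−s,ψ̄)|² ≪ P²𝓛³⁶`" (for `𝐚₁, 𝐚₂` satisfying (7.2)). Input: `Skeleton.Lemma33b`.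
[cite: Zhang2022LandauSiegel, §8 p.43, tex L2248–2250] -/
def Step8u014 : Prop :=
  ∀ B : ℝ, ∃ C : ℝ, ForAllLarge fun D _ χ => AssumptionA D χ →
    ∀ a₁ a₂ : ℕ → ℂ, Adm72 D B a₁ → Adm72 D B a₂ → ∀ s : ℂ, onJ D (alpha D) s →
      ∑ x ∈ finsetOf (PsiOne χ), ‖Apoly x a₁ s * ApolyBar x a₂ (1 - s)‖ ^ 2 ≤
        C * bigP D ^ 2 * ell D ^ 36

/-- `Z22:§8.u015` CLAIM (p.43, tex L2251–2254): "These estimates together with (7.4) and (2.9) imply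
`Σ_{ψ∈Ψ₁} (Ĩ₁⁺(𝐚₁,𝐚₂;ψ) − I₁⁺(𝐚₁,𝐚₂;ψ)) = o(𝔓)`". Inputs: `Step8u012`–`Step8u014`, (7.4)
(`Section7aStatements`, L2-t2), (2.9) (`Skeleton.frakP`, `frakP_bounds`).
[cite: Zhang2022LandauSiegel, §8 p.43, tex L2251–2254] -/
def Step8u015 : Prop :=
  ∀ B : ℝ, ∀ ε : ℝ, 0 < ε → ForAllLarge fun D _ χ => AssumptionA D χ →
    ∀ a₁ a₂ : ℕ → ℂ, Adm72 D B a₁ → Adm72 D B a₂ →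
      ‖∑ x ∈ finsetOf (PsiOne χ), (Itil c' x (alpha D) a₁ a₂ - IonePlus c' x a₁ a₂)‖ ≤ ε * frakP D

/-- `Z22:§8.u016` CLAIM (p.43, tex L2255–2258): "On the other hand, moving the segment `𝔍(α)` to `𝔍(1)`
gives `Σ_{ψ∈Ψ₁} I₁⁺(𝐚₁,𝐚₂;ψ) = Θ₁(𝐚₁,𝐚₂) + O(ε)`" (`Θ₁` = the same integrals over `𝔍(1)`,
`Skeleton.Theta1`; `ε = exp{−c𝓛¹⁰}`). [cite: Zhang2022LandauSiegel, §8 p.43, tex L2255–2258] -/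
def Step8u016 : Prop :=
  ∀ B : ℝ, ∃ c : ℝ, 0 < c ∧ ∃ C : ℝ, ForAllLarge fun D _ χ => AssumptionA D χ →
    ∀ a₁ a₂ : ℕ → ℂ, Adm72 D B a₁ → Adm72 D B a₂ →
      ‖(∑ x ∈ finsetOf (PsiOne χ), IonePlus c' x a₁ a₂) - Theta1 c' χ a₁ a₂‖ ≤
        C * Real.exp (-c * ell D ^ 10)

/-- `Z22:§8.u017` CLAIM (p.44, tex L2259–2263): "Hence `Σ_{ψ∈Ψ₁} Ĩ₁⁺(𝐚₁,𝐚₂;ψ) = Θ₁(𝐚₁,𝐚₂) + o(𝔓)`.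
For the sum of `conj Ĩ₁⁺(ā₂,ā₁;ψ)` a similar result holds" (the latter is this claim at `(ā₂, ā₁)`,
conjugated). Edge: `step8u017_of`. [cite: Zhang2022LandauSiegel, §8 p.44, tex L2259–2263] -/
def Step8u017 : Prop :=
  ∀ B : ℝ, ∀ ε : ℝ, 0 < ε → ForAllLarge fun D _ χ => AssumptionA D χ →
    ∀ a₁ a₂ : ℕ → ℂ, Adm72 D B a₁ → Adm72 D B a₂ →
      ‖(∑ x ∈ finsetOf (PsiOne χ), Itil c' x (alpha D) a₁ a₂) - Theta1 c' χ a₁ a₂‖ ≤ ε * frakP D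

/-- IMPLICIT INPUT of `Z22:Lem8.1.pf` (summing the per-`ψ` error `O(ε)` of §8.u010 over `ψ ∈ Ψ₁`):
`#Ψ₁ ≤ #Ψ ≤ 𝔓` (each prime `p ∼ P` carries `p − 2 < p` primitive characters; `𝔓 = Σ_{p∼P} p`, (2.9)).
Standard; not displayed. [cite: Zhang2022LandauSiegel, §2 (2.9) p.4] -/
def CardPsiOneLe : Prop :=
  ∀ (D : ℕ) [NeZero D] (χ : DirichletCharacter ℂ D), ((finsetOf (PsiOne χ)).card : ℝ) ≤ frakP D

/-- `Z22:Lem8.1.pf` DEDUCTION (pp.42–44, tex L2193–2263), refining the banked `Skeleton.Ded81 c′`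
(`Prop22 → Lemma33b → Lemma52 → Lemma59 → Lemma61 → Lemma81`) through the proof's own steps: the
per-`ψ` formula §8.u010, the evaluation §8.u017 (used for `(𝐚₁,𝐚₂)` and for `(ā₂,ā₁)`), and the
count `#Ψ₁ ≤ 𝔓`, give Lemma 8.1. PROVED: `dedLem81_holds`. [cite: Zhang2022LandauSiegel, §8 pp.42–44, tex L2193–2263] -/
def DedLem81 : Prop := Step8u010 c' → Step8u017 c' → CardPsiOneLe → Skeleton.Lemma81 c'

end Claims

/-! ## Kernel edges and discharges from `Section8Reflection` -/

section Proofs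

variable {c' : ℝ}

/-- `L₀ ≤ log D` once `D ≥ ⌈exp L₀⌉₊`. [folklore] -/
private theorem le_log_of_ceil_exp_le {L₀ : ℝ} {D : ℕ} (hD : ⌈Real.exp L₀⌉₊ ≤ D) :
    L₀ ≤ Real.log D := by
  have h : Real.exp L₀ ≤ D := le_trans (Nat.le_ceil _) (by exact_mod_cast hD)
  exact (Real.le_log_iff_exp_le (lt_of_lt_of_le (Real.exp_pos _) h)).mpr h

/-- `α𝓛 = π𝓛⁻⁸` (`α = π/log P = π𝓛⁻⁹`). [cite: Zhang2022LandauSiegel, §2 (2.10)] -/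
private theorem alpha_mul_ell {D : ℕ} (hℓ : ell D ≠ 0) : alpha D * ell D = π / ell D ^ 8 := by
  rw [alpha, log_bigP]
  field_simp

/-- For large `D`: `𝓛₁ < 2πt₀` (`𝓛⁴⁰⁵ < 2π𝓛⁵¹⁹`), the shift sizes `b_j` of (2.13) are non-negative,
and `α > 0`. [cite: Zhang2022LandauSiegel, §2 (2.8), (2.10), (2.13)] -/
private theorem eventually_heights (c' : ℝ) :
    ∃ D₀ : ℕ, ∀ D : ℕ, D₀ ≤ D →
      ell1 D < 2 * π * t0 D ∧ 0 ≤ b1 c' D ∧ 0 ≤ b2 c' D ∧ 0 ≤ b3 c' D ∧ 0 < alpha D := by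
  refine ⟨⌈Real.exp (5 * |c'| * π + 1)⌉₊, fun D hD => ?_⟩
  have hℓ : 5 * |c'| * π + 1 ≤ ell D := le_log_of_ceil_exp_le hD
  have hc0 : 0 ≤ 5 * |c'| * π := by positivity
  have hℓ1 : 1 ≤ ell D := by linarith
  have hℓ0 : 0 < ell D := by linarith
  have hα : 0 < alpha D := by
    rw [alpha, log_bigP]; positivity
  have hℓ8 : ell D ≤ ell D ^ 8 := by
    calc ell D = ell D ^ 1 := (pow_one _).symm
      _ ≤ ell D ^ 8 := pow_le_pow_right₀ hℓ1 (by norm_num)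
  -- `|c′|·α𝓛 = |c′|π/𝓛⁸ ≤ |c′|π/𝓛 ≤ 1/5`
  have hkey : |c'| * (alpha D * ell D) ≤ 1 / 5 := by
    rw [alpha_mul_ell hℓ0.ne']
    have h1 : |c'| * (π / ell D ^ 8) ≤ |c'| * (π / ell D) := by
      apply mul_le_mul_of_nonneg_left _ (abs_nonneg _)
      exact div_le_div_of_nonneg_left Real.pi_pos.le hℓ0 hℓ8
    have h2 : |c'| * (π / ell D) ≤ 1 / 5 := by
      rw [← mul_div_assoc, div_le_iff₀ hℓ0]
      linarith
    exact h1.trans h2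
  have hcb : |c' * (alpha D * ell D)| ≤ 1 / 5 := by
    rw [abs_mul, abs_of_nonneg (mul_pos hα hℓ0).le]; exact hkey
  have hcb' := abs_le.mp hcb
  refine ⟨?_, ?_, ?_, ?_, hα⟩
  · -- `𝓛⁴⁰⁵ ≤ 𝓛⁵¹⁹ < 2π𝓛⁵¹⁹`
    rw [ell1, t0]
    have h1 : ell D ^ 405 ≤ ell D ^ 519 := pow_le_pow_right₀ hℓ1 (by norm_num)
    have h2 : 0 < ell D ^ 519 := by positivity
    have h3 : (1 : ℝ) < 2 * π := by linarith [Real.pi_gt_three]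
    nlinarith
  · rw [b1]
    apply mul_nonneg hα.le
    have : 5 * c' * alpha D * ell D = 5 * (c' * (alpha D * ell D)) := by ring
    rw [this]; linarith [hcb'.2]
  · rw [b2]
    apply mul_nonneg (by positivity)
    have : c' * alpha D * ell D = c' * (alpha D * ell D) := by ring
    rw [this]; linarith [hcb'.1]
  · rw [b3]
    apply mul_nonneg (by positivity)
    have : c' * alpha D * ell D = c' * (alpha D * ell D) := by ring
    rw [this]; linarith [hcb'.2]

/-- Points of `𝔍(z)` lie in the upper half-plane once `𝓛₁ < 2πt₀`: `Im s = 2πt₀ + v ≥ 2πt₀ − 𝓛₁ > 0`.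
[cite: Zhang2022LandauSiegel, §7 p.33, tex L1824] -/
private theorem im_pos_of_onJ {D : ℕ} (hL : ell1 D < 2 * π * t0 D) {z : ℝ} {s : ℂ}
    (h : onJ D z s) : 0 < s.im := by
  obtain ⟨v, hv, rfl⟩ := h
  rw [s0, SmoothWeight.s0_def]
  simp only [Complex.add_im, Complex.ofReal_im, Complex.mul_im, Complex.ofReal_re, Complex.I_im,
    Complex.I_re, Complex.div_ofNat_im, Complex.one_im, Complex.mul_re, Complex.re_ofNat,
    Complex.im_ofNat, Complex.ofReal_im, zero_add, mul_zero, sub_zero, mul_one, zero_div]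
  have := abs_le.mp hv
  nlinarith [Real.pi_pos]

/-- `Z22:§8.u007` holds: `conj 𝒞̃(s,ψ) = −𝒞̃(s′,ψ)` on `𝔍(α)`, for all large `D` and every `ψ ∈ Ψ` —
the tree's `Lemma81.conj_calCtilde_eq` (`Section8Reflection`: Schwarz reflection `conj M(s) = M(1−s̄)`
from (2.11) by the identity theorem) through the bridge `calCt_eq_calCtilde`; the side conditions
`Im s > 0`, `Im s + b_j > 0` hold on `𝔍(α)` for large `D` (`eventually_heights`).
[cite: Zhang2022LandauSiegel, §8 p.43, tex L2219–2222] -/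
theorem step8u007_holds (c' : ℝ) : Step8u007 c' := by
  obtain ⟨D₀, hD₀⟩ := eventually_heights c'
  refine ⟨D₀, fun D _ χ hD _ _ x s hs => ?_⟩
  obtain ⟨hL, hb1, hb2, hb3, _⟩ := hD₀ D hD
  have him : 0 < s.im := im_pos_of_onJ hL hs
  obtain ⟨hYd, hY⟩ := Yroot_spec x.prim
  rw [calCt_eq_calCtilde, calCt_eq_calCtilde, sPrime]
  exact Lemma81.conj_calCtilde_eq x.prim x.p_ne_one hYd hY him (by linarith) (by linarith)
    (by linarith)

variable (c' : ℝ) in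
/-- `Step8u007` — `_holds` alias of `step8u007_holds` above under the fact's exact name, stated under the
prover's own binders as section variables (appended 2026-08-28, D-0026 bookkeeping: the proof term is the
existing theorem of this file; no statement, definition or attribute is edited; no new named fact; the
ledger's debt table listed the fact unproved). [cite: Zhang2022LandauSiegel, §8 p.43, tex L2219–2222] -/
theorem _root_.Literature.NumberTheory.LFunctions.Zhang2022.Section8aStatements.Step8u007_holds :
    _root_.Literature.NumberTheory.LFunctions.Zhang2022.Section8aStatements.Step8u007 c' :=
  _root_.Literature.NumberTheory.LFunctions.Zhang2022.Section8aStatements.step8u007_holds (c' := c')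

/-- `Z22:§8.u009` holds: `−Ĩ₁⁻(𝐚₁,𝐚₂;ψ) = conj Ĩ₁⁺(ā₂,ā₁;ψ)` for all large `D`, every `ψ ∈ Ψ` and all
`𝐚₁, 𝐚₂` — the tree's `Lemma81.neg_Itilde_neg_eq_conj` through the bridge `Itil_eq_Itilde`
(`|𝓛₁| < 2πt₀` and `b_j ≥ 0` for large `D`). [cite: Zhang2022LandauSiegel, §8 p.43, tex L2227–2230] -/
theorem step8u009_holds (c' : ℝ) : Step8u009 c' := by
  obtain ⟨D₀, hD₀⟩ := eventually_heights c'
  refine ⟨D₀, fun D _ χ hD _ _ x a₁ a₂ => ?_⟩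
  obtain ⟨hL, hb1, hb2, hb3, _⟩ := hD₀ D hD
  obtain ⟨hYd, hY⟩ := Yroot_spec x.prim
  have hL' : |ell1 D| < 2 * π * t0 D := by
    rwa [abs_of_nonneg (by rw [ell1, ell]; exact pow_nonneg (Real.log_natCast_nonneg D) _)]
  rw [Itil_eq_Itilde, Itil_eq_Itilde, Complex.ofReal_neg]
  have := Lemma81.neg_Itilde_neg_eq_conj x.prim x.p_ne_one hYd hY hb1 hb2 hb3 (Nsupp D) (ell2 D)
    hL' (alpha D) a₁ a₂
  rw [Complex.ofReal_neg] at this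
  exact this

variable (c' : ℝ) in
/-- `Step8u009` — `_holds` alias of `step8u009_holds` above under the fact's exact name, stated under the
prover's own binders as section variables (appended 2026-08-28, D-0026 bookkeeping: the proof term is the
existing theorem of this file; no statement, definition or attribute is edited; no new named fact; the
ledger's debt table listed the fact unproved). [cite: Zhang2022LandauSiegel, §8 p.43, tex L2227–2230] -/
theorem _root_.Literature.NumberTheory.LFunctions.Zhang2022.Section8aStatements.Step8u009_holds :
    _root_.Literature.NumberTheory.LFunctions.Zhang2022.Section8aStatements.Step8u009 c' :=
  _root_.Literature.NumberTheory.LFunctions.Zhang2022.Section8aStatements.step8u009_holds (c' := c')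

/-- (7.2) is stable under conjugation of the sequence (`‖ā(n)‖ = ‖a(n)‖`, same support) — needed to
apply §8.u017 at `(ā₂, ā₁)`. [cite: Zhang2022LandauSiegel, §7 (7.2) p.33] -/
theorem adm72_conj {D : ℕ} {B : ℝ} {a : ℕ → ℂ} (h : Adm72 D B a) :
    Adm72 D B (fun n => conj (a n)) :=
  ⟨fun n => by rw [Complex.norm_conj]; exact h.1 n, fun n hn => by simp [h.2 n hn]⟩

/-- Zhang's negligible `ε = exp{−c𝓛¹⁰}` times any constant is eventually below any `η > 0`
(`exp(c𝓛¹⁰) ≥ 1 + c𝓛¹⁰ ≥ c𝓛`). [cite: Zhang2022LandauSiegel, §4 p.19, tex L1062] -/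
private theorem exp_neg_eventually_le {c : ℝ} (hc : 0 < c) (C η : ℝ) (hη : 0 < η) :
    ∃ D₀ : ℕ, ∀ D : ℕ, D₀ ≤ D → C * Real.exp (-c * ell D ^ 10) ≤ η := by
  refine ⟨⌈Real.exp (max 1 ((|C| + 1) / (c * η)))⌉₊, fun D hD => ?_⟩
  have hℓ : max 1 ((|C| + 1) / (c * η)) ≤ ell D := le_log_of_ceil_exp_le hD
  have hℓ1 : 1 ≤ ell D := le_trans (le_max_left _ _) hℓ
  have hℓ2 : (|C| + 1) / (c * η) ≤ ell D := le_trans (le_max_right _ _) hℓ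
  have hℓ10 : ell D ≤ ell D ^ 10 := by
    calc ell D = ell D ^ 1 := (pow_one _).symm
      _ ≤ ell D ^ 10 := pow_le_pow_right₀ hℓ1 (by norm_num)
  have hE := Real.add_one_le_exp (c * ell D ^ 10)
  have hCle : |C| + 1 ≤ ell D * (c * η) := (div_le_iff₀ (by positivity)).mp hℓ2
  have hEpos : 0 < Real.exp (c * ell D ^ 10) := Real.exp_pos _
  have hmono : η * c * ell D ≤ η * c * ell D ^ 10 := mul_le_mul_of_nonneg_left hℓ10 (by positivity)
  rw [neg_mul, Real.exp_neg, ← div_eq_mul_inv, div_le_iff₀ hEpos]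
  calc C ≤ |C| := le_abs_self C
    _ ≤ η * c * ell D - 1 := by linarith
    _ ≤ η * (c * ell D ^ 10) := by linarith
    _ ≤ η * Real.exp (c * ell D ^ 10) := mul_le_mul_of_nonneg_left (by linarith) hη.le

/-- **`𝔓 ≥ 1` for large `D`** ((2.9): `𝔓 = (1 + O(𝓛⁻⁶⁸))P²𝓛⁻⁷⁷`, the tree's `frakP_bounds`, and
`P² = exp(2𝓛⁹) ≥ (2𝓛⁹)⁹/9! ≥ 2𝓛⁷⁷` once `𝓛 ≥ 7`). [cite: Zhang2022LandauSiegel, §2 (2.9) p.4] -/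
private theorem one_le_frakP_eventually : ∃ D₀ : ℕ, ∀ D : ℕ, D₀ ≤ D → 1 ≤ frakP D := by
  obtain ⟨D₀, h⟩ := frakP_bounds
  refine ⟨max D₀ ⌈Real.exp 7⌉₊, fun D hD => ?_⟩
  have hD₀ : D₀ ≤ D := le_trans (le_max_left _ _) hD
  have hL7 : (7 : ℝ) ≤ Real.log D := le_log_of_ceil_exp_le (le_trans (le_max_right _ _) hD)
  set L := Real.log D with hL
  set M := Real.exp (L ^ 9) ^ 2 * (L ^ 77)⁻¹ with hM
  have hL0 : 0 < L := by linarith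
  have hL77 : 0 < L ^ 77 := by positivity
  have hb := abs_le.mp (h D hD₀)
  -- `3𝓛⁻⁶⁸ ≤ 1/2`
  have hL68 : 6 ≤ L ^ 68 := by
    calc (6 : ℝ) ≤ 7 ^ 1 := by norm_num
      _ ≤ L ^ 1 := by rw [pow_one, pow_one]; exact hL7
      _ ≤ L ^ 68 := pow_le_pow_right₀ (by linarith) (by norm_num)
  have hsmall : 3 * (L ^ 68)⁻¹ ≤ 1 / 2 := by
    rw [inv_eq_one_div, mul_one_div, div_le_iff₀ (by positivity)]
    linarith
  -- `M ≥ 2`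
  have hL4 : (2401 : ℝ) ≤ L ^ 4 := by
    have := pow_le_pow_left₀ (by norm_num : (0 : ℝ) ≤ 7) hL7 4
    linarith [show (7 : ℝ) ^ 4 = 2401 by norm_num]
  have key : 2 * L ^ 77 ≤ Real.exp (L ^ 9) ^ 2 := by
    have h1 : (2 * L ^ 9) ^ 9 / (Nat.factorial 9 : ℝ) ≤ Real.exp (2 * L ^ 9) :=
      Real.pow_div_factorial_le_exp (2 * L ^ 9) (by positivity) 9
    have h2 : Real.exp (L ^ 9) ^ 2 = Real.exp (2 * L ^ 9) := by
      rw [← Real.exp_nat_mul]; norm_num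
    have h3 : (Nat.factorial 9 : ℝ) = 362880 := by norm_num [Nat.factorial]
    rw [h2]
    refine le_trans ?_ h1
    rw [h3, le_div_iff₀ (by norm_num)]
    calc 2 * L ^ 77 * 362880 = 725760 * L ^ 77 := by ring
      _ ≤ 512 * L ^ 4 * L ^ 77 := by nlinarith
      _ = (2 * L ^ 9) ^ 9 := by ring
  have hM2 : 2 ≤ M := by
    rw [hM, ← div_eq_mul_inv, le_div_iff₀ hL77]
    exact key
  nlinarith [hb.1, hsmall, hM2, mul_nonneg (by linarith : (0:ℝ) ≤ 1 / 2 - 3 * (L ^ 68)⁻¹) (by linarith : (0:ℝ) ≤ M)]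

/-- `Z22:§8.u010` from (8.1) and §8.u009 ("These together imply … Hence"): substitute
`−Ĩ₁⁻ = conj Ĩ₁⁺(ā₂,ā₁)` into (8.1) (the same algebra as the tree's `Lemma81.sum_eq_Itilde_add_conj`).
Kernel edge. [cite: Zhang2022LandauSiegel, §8 p.43, tex L2231–2235] -/
theorem step8u010_of (h81 : Eq81 c') (h9 : Step8u009 c') : Step8u010 c' := by
  intro B
  obtain ⟨c, hc, C, h81'⟩ := h81 B
  refine ⟨c, hc, C, (h81'.and h9).mono fun D _ χ _ _ h => ?_⟩
  obtain ⟨h81D, h9D⟩ := h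
  intro hA a₁ a₂ ha₁ ha₂ x hx
  rw [← h9D x a₁ a₂, ← sub_eq_add_neg]
  exact h81D hA a₁ a₂ ha₁ ha₂ x hx

/-- `Z22:§8.u017` from §8.u015 and §8.u016 ("Hence"): `ΣĨ₁⁺ − Θ₁ = Σ(Ĩ₁⁺ − I₁⁺) + (ΣI₁⁺ − Θ₁)
= o(𝔓) + O(ε) = o(𝔓)` (`ε = exp{−c𝓛¹⁰} = o(1)` and `𝔓 ≥ 1` eventually). Kernel edge.
[cite: Zhang2022LandauSiegel, §8 p.44, tex L2259–2262] -/
theorem step8u017_of (h15 : Step8u015 c') (h16 : Step8u016 c') : Step8u017 c' := by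
  intro B ε hε
  obtain ⟨c, hc, C, h16'⟩ := h16 B
  obtain ⟨D₁, hD₁⟩ := exp_neg_eventually_le hc C (ε / 2) (by positivity)
  obtain ⟨D₂, hD₂⟩ := one_le_frakP_eventually
  obtain ⟨D₀, h⟩ := (h15 B (ε / 2) (by positivity)).and h16'
  refine ⟨max D₀ (max D₁ D₂), fun D _ χ hD hq hp hA a₁ a₂ ha₁ ha₂ => ?_⟩
  have hD₀ : D₀ ≤ D := le_trans (le_max_left _ _) hD
  have hD₁' : D₁ ≤ D := le_trans (le_trans (le_max_left _ _) (le_max_right _ _)) hD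
  have hD₂' : D₂ ≤ D := le_trans (le_trans (le_max_right _ _) (le_max_right _ _)) hD
  obtain ⟨h15D, h16D⟩ := h D χ hD₀ hq hp
  have e1 := h15D hA a₁ a₂ ha₁ ha₂
  have e2 := h16D hA a₁ a₂ ha₁ ha₂
  have e3 : C * Real.exp (-c * ell D ^ 10) ≤ ε / 2 * frakP D := by
    calc C * Real.exp (-c * ell D ^ 10) ≤ ε / 2 := hD₁ D hD₁'
      _ = ε / 2 * 1 := (mul_one _).symm
      _ ≤ ε / 2 * frakP D := mul_le_mul_of_nonneg_left (hD₂ D hD₂') (by positivity)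
  have key : (∑ x ∈ finsetOf (PsiOne χ), Itil c' x (alpha D) a₁ a₂) - Theta1 c' χ a₁ a₂ =
      (∑ x ∈ finsetOf (PsiOne χ), (Itil c' x (alpha D) a₁ a₂ - IonePlus c' x a₁ a₂)) +
        ((∑ x ∈ finsetOf (PsiOne χ), IonePlus c' x a₁ a₂) - Theta1 c' χ a₁ a₂) := by
    rw [Finset.sum_sub_distrib]; ring
  rw [key]
  calc _ ≤ ‖∑ x ∈ finsetOf (PsiOne χ), (Itil c' x (alpha D) a₁ a₂ - IonePlus c' x a₁ a₂)‖ +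
        ‖(∑ x ∈ finsetOf (PsiOne χ), IonePlus c' x a₁ a₂) - Theta1 c' χ a₁ a₂‖ := norm_add_le _ _
    _ ≤ ε / 2 * frakP D + ε / 2 * frakP D := add_le_add e1 (e2.trans e3)
    _ = ε * frakP D := by ring

/-- **`Z22:Lem8.1.pf` — the deduction holds**: §8.u010 (per `ψ`, error `O(ε)` uniform in `ψ ∈ Ψ₁`),
§8.u017 for `(𝐚₁,𝐚₂)` and for `(ā₂,ā₁)` (conjugated: "a similar result holds"), and `#Ψ₁ ≤ 𝔓` give the
banked `Skeleton.Lemma81 c′` ("This completes the proof"). Kernel edge, pure bookkeeping.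
[cite: Zhang2022LandauSiegel, §8 pp.43–44, tex L2231–2263] -/
theorem dedLem81_holds (c' : ℝ) : DedLem81 c' := by
  intro h10 h17 hcard B ε hε
  obtain ⟨c, hc, C, h10'⟩ := h10 B
  obtain ⟨D₁, hD₁⟩ := exp_neg_eventually_le hc C (ε / 3) (by positivity)
  obtain ⟨D₀, h⟩ := h10'.and (h17 B (ε / 3) (by positivity))
  refine ⟨max D₀ D₁, fun D _ χ hD hq hp hA a₁ a₂ ha₁ ha₂ => ?_⟩
  have hD₀ : D₀ ≤ D := le_trans (le_max_left _ _) hD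
  have hD₁' : D₁ ≤ D := le_trans (le_max_right _ _) hD
  obtain ⟨h10D, h17D⟩ := h D χ hD₀ hq hp
  set S := finsetOf (PsiOne χ) with hS
  set b₁ : ℕ → ℂ := fun n => conj (a₁ n) with hb₁
  set b₂ : ℕ → ℂ := fun n => conj (a₂ n) with hb₂
  have hb₁A : Adm72 D B b₁ := adm72_conj ha₁
  have hb₂A : Adm72 D B b₂ := adm72_conj ha₂
  have e1 : ∀ x ∈ S, ‖sumZeros c' x a₁ a₂ -
      (Itil c' x (alpha D) a₁ a₂ + conj (Itil c' x (alpha D) b₂ b₁))‖ ≤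
        C * Real.exp (-c * ell D ^ 10) :=
    fun x hx => h10D hA a₁ a₂ ha₁ ha₂ x (mem_of_mem_finsetOf hx)
  have e2 : ‖(∑ x ∈ S, Itil c' x (alpha D) a₁ a₂) - Theta1 c' χ a₁ a₂‖ ≤ ε / 3 * frakP D :=
    h17D hA a₁ a₂ ha₁ ha₂
  have e3 : ‖(∑ x ∈ S, Itil c' x (alpha D) b₂ b₁) - Theta1 c' χ b₂ b₁‖ ≤ ε / 3 * frakP D :=
    h17D hA b₂ b₁ hb₂A hb₁A
  have e4 : C * Real.exp (-c * ell D ^ 10) ≤ ε / 3 := hD₁ D hD₁'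
  have hcardD : (S.card : ℝ) ≤ frakP D := hcard D χ
  have key : lhs81 c' χ a₁ a₂ - (Theta1 c' χ a₁ a₂ + conj (Theta1 c' χ b₂ b₁)) =
      (∑ x ∈ S, (sumZeros c' x a₁ a₂ -
          (Itil c' x (alpha D) a₁ a₂ + conj (Itil c' x (alpha D) b₂ b₁)))) +
        (((∑ x ∈ S, Itil c' x (alpha D) a₁ a₂) - Theta1 c' χ a₁ a₂) +
          conj ((∑ x ∈ S, Itil c' x (alpha D) b₂ b₁) - Theta1 c' χ b₂ b₁)) := by
    rw [lhs81_eq_sum_sumZeros, map_sub, map_sum, Finset.sum_sub_distrib, Finset.sum_add_distrib]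
    ring
  rw [key]
  have s1 : ‖∑ x ∈ S, (sumZeros c' x a₁ a₂ -
      (Itil c' x (alpha D) a₁ a₂ + conj (Itil c' x (alpha D) b₂ b₁)))‖ ≤ ε / 3 * frakP D := by
    calc _ ≤ ∑ x ∈ S, ‖sumZeros c' x a₁ a₂ -
            (Itil c' x (alpha D) a₁ a₂ + conj (Itil c' x (alpha D) b₂ b₁))‖ := norm_sum_le _ _
      _ ≤ ∑ x ∈ S, C * Real.exp (-c * ell D ^ 10) := Finset.sum_le_sum e1
      _ = S.card * (C * Real.exp (-c * ell D ^ 10)) := by rw [Finset.sum_const, nsmul_eq_mul]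
      _ ≤ S.card * (ε / 3) := mul_le_mul_of_nonneg_left e4 (Nat.cast_nonneg _)
      _ ≤ frakP D * (ε / 3) := mul_le_mul_of_nonneg_right hcardD (by positivity)
      _ = ε / 3 * frakP D := by ring
  calc _ ≤ ‖∑ x ∈ S, (sumZeros c' x a₁ a₂ -
            (Itil c' x (alpha D) a₁ a₂ + conj (Itil c' x (alpha D) b₂ b₁)))‖ +
          ‖((∑ x ∈ S, Itil c' x (alpha D) a₁ a₂) - Theta1 c' χ a₁ a₂) +
            conj ((∑ x ∈ S, Itil c' x (alpha D) b₂ b₁) - Theta1 c' χ b₂ b₁)‖ := norm_add_le _ _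
    _ ≤ ε / 3 * frakP D + (ε / 3 * frakP D + ε / 3 * frakP D) := by
        refine add_le_add s1 (le_trans (norm_add_le _ _) (add_le_add e2 ?_))
        rw [Complex.norm_conj]; exact e3
    _ = ε * frakP D := by ring

variable (c' : ℝ) in
/-- `DedLem81` — `_holds` alias of `dedLem81_holds` above under the fact's exact name, stated under the
prover's own binders as section variables (appended 2026-08-28, D-0026 bookkeeping: the proof term is the
existing theorem of this file; no statement, definition or attribute is edited; no new named fact; the
ledger's debt table listed the fact unproved). [cite: Zhang2022LandauSiegel, §8 pp.43–44, tex L2231–2263] -/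
theorem _root_.Literature.NumberTheory.LFunctions.Zhang2022.Section8aStatements.DedLem81_holds :
    _root_.Literature.NumberTheory.LFunctions.Zhang2022.Section8aStatements.DedLem81 c' :=
  _root_.Literature.NumberTheory.LFunctions.Zhang2022.Section8aStatements.dedLem81_holds (c' := c')

end Proofs

/-! ## The implicit count `#Ψ₁ ≤ 𝔓` holds; Lemma 8.1 from §8.u010 and §8.u017 alone -/

section Count

/-- `Chr.toSigma` (a member of `Ψ` ↦ its modulus in the window and its character) is injective.
[folklore] -/
private theorem toSigma_injective (D : ℕ) : Function.Injective (Chr.toSigma (D := D)) := by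
  rintro ⟨p, hp, ψ, hψ⟩ ⟨p', hp', ψ', hψ'⟩ h
  simp only [Chr.toSigma, Sigma.mk.injEq, Subtype.mk.injEq] at h
  obtain ⟨rfl, h2⟩ := h
  simp only [heq_eq_eq] at h2
  subst h2
  rfl

/-- `ℂ` has enough roots of unity for `(ZMod q)ˣ` (so that characters mod `q` can be counted).
[folklore] -/
private theorem hasEnoughRootsOfUnity_zmod (q : ℕ) [NeZero q] :
    HasEnoughRootsOfUnity ℂ (Monoid.exponent (ZMod q)ˣ) := by
  haveI : NeZero ((Monoid.exponent (ZMod q)ˣ : ℕ) : ℂ) :=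
    ⟨Nat.cast_ne_zero.mpr Monoid.exponent_ne_zero_of_finite⟩
  infer_instance

/-- The number of Dirichlet characters mod `q` with values in `ℂ` is `φ(q) ≤ q` (there are exactly
`φ(q)` characters mod `q`). [cite: MontgomeryVaughan2007, §4.2 Cor. 4.5] -/
theorem natCard_dirichletCharacter_le (q : ℕ) [NeZero q] :
    Nat.card (DirichletCharacter ℂ q) ≤ q := by
  haveI := hasEnoughRootsOfUnity_zmod q
  rw [DirichletCharacter, MulChar.card_eq_card_units_of_hasEnoughRootsOfUnity (ZMod q) ℂ,
    Nat.card_eq_fintype_card, ZMod.card_units_eq_totient]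
  exact Nat.totient_le q

/-- **The implicit input `CardPsiOneLe` holds**: `#Ψ₁ ≤ #Ψ ≤ Σ_{p∼P} #{characters mod p} = Σ_{p∼P} φ(p)
≤ Σ_{p∼P} p = 𝔓` (for every `D`). [cite: Zhang2022LandauSiegel, §2 (2.9) p.4] -/
theorem cardPsiOneLe_holds : CardPsiOneLe := by
  intro D _ χ
  classical
  haveI : Fintype (Chr D) := Fintype.ofFinite _
  haveI : ∀ q : primeWindow D, Fintype (DirichletCharacter ℂ (q : ℕ)) := fun q => Fintype.ofFinite _
  have h1 : (finsetOf (PsiOne χ)).card ≤ Fintype.card (Chr D) := Finset.card_le_univ _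
  have h2 : Fintype.card (Chr D) ≤
      Fintype.card ((q : primeWindow D) × DirichletCharacter ℂ (q : ℕ)) :=
    Fintype.card_le_of_injective _ (toSigma_injective D)
  have h3 : Fintype.card ((q : primeWindow D) × DirichletCharacter ℂ (q : ℕ)) ≤
      ∑ q : primeWindow D, (q : ℕ) := by
    rw [Fintype.card_sigma]
    refine Finset.sum_le_sum fun q _ => ?_
    rw [← Nat.card_eq_fintype_card]
    exact natCard_dirichletCharacter_le (q : ℕ)
  have h4 : (∑ q : primeWindow D, ((q : ℕ) : ℝ)) = frakP D := by
    rw [frakP_eq_sum_primeWindow, ← Finset.sum_coe_sort (primeWindow D)]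
  calc ((finsetOf (PsiOne χ)).card : ℝ) ≤ ((∑ q : primeWindow D, (q : ℕ) : ℕ) : ℝ) := by
        exact_mod_cast h1.trans (h2.trans h3)
    _ = frakP D := by rw [← h4]; push_cast; rfl

/-- **Lemma 8.1 from the two evaluated steps of its proof**: §8.u010 (the per-`ψ` formula with
`O(ε)`) and §8.u017 (the sum of `Ĩ₁⁺` is `Θ₁ + o(𝔓)`) imply the banked `Skeleton.Lemma81 c′`
(`dedLem81_holds` with the count `cardPsiOneLe_holds` supplied). [cite: Zhang2022LandauSiegel, §8 pp.42–44, tex L2193–2263] -/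
theorem lemma81_of_u010_u017 {c' : ℝ} (h10 : Step8u010 c') (h17 : Step8u017 c') : Skeleton.Lemma81 c' :=
  dedLem81_holds c' h10 h17 cardPsiOneLe_holds

end Count

/-! ## (8.1) assembled from its two halves and the rectangle -/

/-- **`Z22:(8.1)` from its parts**: the rectangle of §8.u003 (`Step8u003`), the residue identity
(`Eq81a`) and the estimate of the contour remainder (`Eq81b`) give the printed (8.1) (`Eq81`). Kernel
edge, pure bookkeeping. [cite: Zhang2022LandauSiegel, §8 (8.1) p.42, tex L2197–2206] -/
theorem eq81_of {c' : ℝ} (h3 : Step8u003) (ha : Eq81a c') (hb : Eq81b c') : Eq81 c' := by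
  intro B
  obtain ⟨C, c₀, hc₀, h3'⟩ := h3
  obtain ⟨c, hc, C', hb'⟩ := hb B C c₀ hc₀
  refine ⟨c, hc, C', ((h3'.and (ha B C c₀ hc₀)).and hb').mono fun D _ χ _ _ h => ?_⟩
  obtain ⟨⟨h3D, haD⟩, hbD⟩ := h
  intro hA a₁ a₂ ha₁ ha₂ x hx
  obtain ⟨Lm, Lp, hR⟩ := h3D hA x hx
  rw [haD hA a₁ a₂ ha₁ ha₂ x hx Lm Lp hR]
  exact hbD hA a₁ a₂ ha₁ ha₂ x hx Lm Lp hR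

/-- **Lemma 8.1 from the analytic leaves of its proof** (all edges of the proof kernel-checked): the
rectangle (§8.u003), the two halves of (8.1), the reflection (§8.u009, PROVED), the estimates §8.u015
(itself ⇐ §8.u012–u014, (7.4), (2.9) — see `Step8u015`) and §8.u016 imply the banked `Skeleton.Lemma81 c′`.
[cite: Zhang2022LandauSiegel, §8 pp.42–44, tex L2193–2263] -/
theorem lemma81_of_leaves {c' : ℝ} (h3 : Step8u003) (ha : Eq81a c') (hb : Eq81b c')
    (h15 : Step8u015 c') (h16 : Step8u016 c') : Skeleton.Lemma81 c' :=
  lemma81_of_u010_u017 (step8u010_of (eq81_of h3 ha hb) (step8u009_holds c'))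
    (step8u017_of h15 h16)

end Literature.NumberTheory.LFunctions.Zhang2022.Section8aStatements
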